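import Summits.QuantumFields.QCD.Theorems.HeatSlicedQuarksQuarkLoopCoefficientSecondOrderExpansionAuxE

/-!
# Second-order expansion of the heat symbol — part F: the closed form of `E₂`
(line `Sketch` of crux stmt-QuantumFields-16786, stub `stub_secondOrderExpansion`, helper file)

Integrating the collapsed Duhamel integrand of part E in `r ∈ [0, s]` gives the closed form of the
second-order term of the flux expansion,
`E₂(s)(w) := −∫₀ˢ freeConv (s−r) (vtx 2 (pert0 r) + vtx 1 (pert1 r)) w dr` (entrywise)
`= Σ_v (s k_s(w−v)/8) • η'(v) + Σ_v (s (v∧w) k_s(w−v)/8) • η(v)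
   + (Σ_v ĥ(v) [ (s/24)(v∧w)² k_s(w−v) − (s²/48) Y_v(s, w−v) ]) • 1
   − Σ_{v,u} (s²/8) k_s(w−v−u) • η(v)η(u) − Σ_{v,u} (s²/8)(v∧u) ĥ(v) k_s(w−v−u) • η(u)`,
with `Y_v(s,x) = v₀² G₁₁ − 2 v₀ v₁ G₀₁ + v₁² G₀₀`, `G_μν(s,x) = Σ_z z_μ z_ν ĥ(z) k_s(x − z)`.
-/

noncomputable section

namespace Summit.QuantumFields.QCD.Cruxes.QuarkLoopCoefficient.Sketch.SecondOrderExpansion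

open Literature.MathematicalPhysics.QuantumLattice Literature.MathematicalPhysics.QuantumFieldTheory
open Literature.Probability.LatticeModels (Site)
open Summit.QuantumFields.QCD.Theorems.QuarkLoopCoefficient
open Summit.QuantumFields.QCD.Cruxes.QuarkLoopCoefficient.Sketch.HeatSeries
open Summit.QuantumFields.QCD.Cruxes.QuarkLoopCoefficient.Sketch.FreeMajorantToolkit
open scoped Matrix ComplexConjugate

/-- The first-order matrix kernel `η(v) = Σ_{z ∈ nbr 0} (z∧v) • ď♯(z) ď(v−z)` (local notation). -/
local notation "η[" v "]" => (∑ z ∈ nbr 0, ((wedge z v : ℤ) : ℂ) • (dsharp z * dsymb (v - z)))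

/-- The second-order matrix kernel `η'(v) = Σ_{z ∈ nbr 0} (z∧v)² • ď♯(z) ď(v−z)` (local notation). -/
local notation "η'[" v "]" => (∑ z ∈ nbr 0, (((wedge z v : ℤ) : ℂ) ^ 2) • (dsharp z * dsymb (v - z)))

/-! ## §14 Scalar integrals and entries of finite combinations -/

/-- `∫₀ˢ (c₀ + c₁ r + c₂ r²) dr = c₀ s + c₁ s²/2 + c₂ s³/3` (complex coefficients). -/
theorem integral_quadratic (c₀ c₁ c₂ : ℂ) (s : ℝ) :
    ∫ r in (0 : ℝ)..s, (c₀ + c₁ * (r : ℂ) + c₂ * (r : ℂ) ^ 2) =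
      c₀ * (s : ℂ) + c₁ * (s : ℂ) ^ 2 / 2 + c₂ * (s : ℂ) ^ 3 / 3 := by
  rw [intervalIntegral.integral_add, intervalIntegral.integral_add, intervalIntegral.integral_const,
    intervalIntegral.integral_const_mul, intervalIntegral.integral_const_mul]
  · have e1 : ∫ r in (0 : ℝ)..s, (r : ℂ) = (s : ℂ) ^ 2 / 2 := by
      rw [intervalIntegral.integral_ofReal, integral_id]; push_cast; ring
    have e2 : ∫ r in (0 : ℝ)..s, (r : ℂ) ^ 2 = (s : ℂ) ^ 3 / 3 := by
      have : (fun r : ℝ => (r : ℂ) ^ 2) = fun r : ℝ => ((r ^ 2 : ℝ) : ℂ) := by funext r; push_cast; ring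
      rw [this, intervalIntegral.integral_ofReal, integral_pow]; push_cast; ring
    rw [e1, e2, sub_zero, Complex.real_smul]; ring
  all_goals exact (by fun_prop : Continuous fun r : ℝ => _).intervalIntegrable _ _

/-- Entrywise integral of a finite combination of constant matrices with continuous coefficients. -/
theorem integral_finset_sum_smul_apply {ι : Type*} (S : Finset ι) (c : ι → ℝ → ℂ) (M : ι → Spin)
    (hc : ∀ i ∈ S, Continuous (c i)) (a b : ℝ) (α β : Fin 4) :
    ∫ r in a..b, (∑ i ∈ S, c i r • M i) α β = ∑ i ∈ S, (∫ r in a..b, c i r) * M i α β := by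
  simp only [Matrix.sum_apply, Matrix.smul_apply, smul_eq_mul]
  have hint : ∀ i ∈ S, IntervalIntegrable (fun r : ℝ => c i r * M i α β) MeasureTheory.volume a b := by
    intro i hi
    apply Continuous.intervalIntegrable
    exact (hc i hi).mul continuous_const
  rw [intervalIntegral.integral_finsetSum hint]
  refine Finset.sum_congr rfl fun i _ => ?_
  exact intervalIntegral.integral_mul_const _ _

/-- Continuity of the entries of a finite combination with continuous coefficients. -/
theorem continuous_finset_sum_smul_apply {ι : Type*} (S : Finset ι) (c : ι → ℝ → ℂ) (M : ι → Spin)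
    (hc : ∀ i ∈ S, Continuous (c i)) (α β : Fin 4) :
    Continuous fun r : ℝ => (∑ i ∈ S, c i r • M i) α β := by
  simp only [Matrix.sum_apply, Matrix.smul_apply, smul_eq_mul]
  refine continuous_finsetSum S fun i hi => ?_
  exact (hc i hi).mul continuous_const

/-! ## §15 The closed form of the second-order term -/

/-- **The collapsed integrand is a quadratic polynomial in `r`** with explicit matrix coefficients:
`G(r,s,w) = P₀ + r • P₁ + r² • P₂`. -/
theorem forcing_collapsed_eq_poly {s : ℝ} (hs : 0 < s) (r : ℝ) (w : Site 4) :
    ∑ v ∈ nbr2 0, (-1 / 8 * ((freeKer s (w - v) : ℝ) : ℂ)) • η'[v] +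
        ∑ v ∈ nbr2 0, (-1 / 4 * ((r : ℂ) / (s : ℂ)) * ((wedge v w : ℤ) : ℂ) * ((freeKer s (w - v) : ℝ) : ℂ)) • η[v] +
        (((∑ v ∈ nbr2 0, -1 / 8 * hhat v * ((r / s) ^ 2 * (((wedge v w : ℤ) : ℝ) ^ 2 * freeKer s (w - v)) -
          (s - r) * r / s *
            (((v 0 : ℤ) : ℝ) ^ 2 * ∑ z ∈ nbr2 0, ((z 1 : ℤ) : ℝ) * ((z 1 : ℤ) : ℝ) * hhat z * freeKer s (w - v - z) -
              2 * ((v 0 : ℤ) : ℝ) * ((v 1 : ℤ) : ℝ) *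
                ∑ z ∈ nbr2 0, ((z 0 : ℤ) : ℝ) * ((z 1 : ℤ) : ℝ) * hhat z * freeKer s (w - v - z) +
              ((v 1 : ℤ) : ℝ) ^ 2 * ∑ z ∈ nbr2 0, ((z 0 : ℤ) : ℝ) * ((z 0 : ℤ) : ℝ) * hhat z * freeKer s (w - v - z))) :
            ℝ)) : ℂ) • (1 : Spin) +
        (∑ v ∈ nbr2 0, ∑ u ∈ nbr2 0, ((r : ℂ) / 4 * ((freeKer s (w - v - u) : ℝ) : ℂ)) • (η[v] * η[u]) +
          ∑ v ∈ nbr2 0, ∑ u ∈ nbr2 0,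
            ((r : ℂ) / 4 * ((wedge v u : ℤ) : ℂ) * ((hhat v : ℝ) : ℂ) * ((freeKer s (w - v - u) : ℝ) : ℂ)) • η[u]) =
      ∑ v ∈ nbr2 0, (-1 / 8 * ((freeKer s (w - v) : ℝ) : ℂ)) • η'[v] +
        (r : ℂ) • (∑ v ∈ nbr2 0, (-1 / 4 / (s : ℂ) * ((wedge v w : ℤ) : ℂ) * ((freeKer s (w - v) : ℝ) : ℂ)) • η[v] +
          (((∑ v ∈ nbr2 0, 1 / 8 * hhat v *
            (((v 0 : ℤ) : ℝ) ^ 2 * ∑ z ∈ nbr2 0, ((z 1 : ℤ) : ℝ) * ((z 1 : ℤ) : ℝ) * hhat z * freeKer s (w - v - z) -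
              2 * ((v 0 : ℤ) : ℝ) * ((v 1 : ℤ) : ℝ) *
                ∑ z ∈ nbr2 0, ((z 0 : ℤ) : ℝ) * ((z 1 : ℤ) : ℝ) * hhat z * freeKer s (w - v - z) +
              ((v 1 : ℤ) : ℝ) ^ 2 * ∑ z ∈ nbr2 0, ((z 0 : ℤ) : ℝ) * ((z 0 : ℤ) : ℝ) * hhat z * freeKer s (w - v - z)) :
            ℝ)) : ℂ) • (1 : Spin) +
          ∑ v ∈ nbr2 0, ∑ u ∈ nbr2 0, (1 / 4 * ((freeKer s (w - v - u) : ℝ) : ℂ)) • (η[v] * η[u]) +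
          ∑ v ∈ nbr2 0, ∑ u ∈ nbr2 0,
            (1 / 4 * ((wedge v u : ℤ) : ℂ) * ((hhat v : ℝ) : ℂ) * ((freeKer s (w - v - u) : ℝ) : ℂ)) • η[u]) +
        (r : ℂ) ^ 2 • ((((∑ v ∈ nbr2 0, -1 / 8 * hhat v *
            ((((wedge v w : ℤ) : ℝ) ^ 2 * freeKer s (w - v)) / s ^ 2 +
              (((v 0 : ℤ) : ℝ) ^ 2 * ∑ z ∈ nbr2 0, ((z 1 : ℤ) : ℝ) * ((z 1 : ℤ) : ℝ) * hhat z * freeKer s (w - v - z) -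
                2 * ((v 0 : ℤ) : ℝ) * ((v 1 : ℤ) : ℝ) *
                  ∑ z ∈ nbr2 0, ((z 0 : ℤ) : ℝ) * ((z 1 : ℤ) : ℝ) * hhat z * freeKer s (w - v - z) +
                ((v 1 : ℤ) : ℝ) ^ 2 * ∑ z ∈ nbr2 0, ((z 0 : ℤ) : ℝ) * ((z 0 : ℤ) : ℝ) * hhat z * freeKer s (w - v - z)) / s) :
            ℝ)) : ℂ) • (1 : Spin)) := by
  have hs' : (s : ℂ) ≠ 0 := Complex.ofReal_ne_zero.mpr hs.ne'
  have hsR : s ≠ 0 := hs.ne'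
  -- group the five pieces: `(A + B + C) + (D + E) = A + r•(B' + C₁ + D' + E') + r²•C₂`
  have hB : ∑ v ∈ nbr2 0, (-1 / 4 * ((r : ℂ) / (s : ℂ)) * ((wedge v w : ℤ) : ℂ) * ((freeKer s (w - v) : ℝ) : ℂ)) • η[v] =
      (r : ℂ) • ∑ v ∈ nbr2 0, (-1 / 4 / (s : ℂ) * ((wedge v w : ℤ) : ℂ) * ((freeKer s (w - v) : ℝ) : ℂ)) • η[v] := by
    rw [Finset.smul_sum]
    refine Finset.sum_congr rfl fun v _ => ?_
    rw [smul_smul]; congr 1; field_simp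
  have hD : ∑ v ∈ nbr2 0, ∑ u ∈ nbr2 0, ((r : ℂ) / 4 * ((freeKer s (w - v - u) : ℝ) : ℂ)) • (η[v] * η[u]) =
      (r : ℂ) • ∑ v ∈ nbr2 0, ∑ u ∈ nbr2 0, (1 / 4 * ((freeKer s (w - v - u) : ℝ) : ℂ)) • (η[v] * η[u]) := by
    rw [Finset.smul_sum]
    refine Finset.sum_congr rfl fun v _ => ?_
    rw [Finset.smul_sum]
    refine Finset.sum_congr rfl fun u _ => ?_
    rw [smul_smul]; congr 1; ring
  have hE : ∑ v ∈ nbr2 0, ∑ u ∈ nbr2 0,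
      ((r : ℂ) / 4 * ((wedge v u : ℤ) : ℂ) * ((hhat v : ℝ) : ℂ) * ((freeKer s (w - v - u) : ℝ) : ℂ)) • η[u] =
      (r : ℂ) • ∑ v ∈ nbr2 0, ∑ u ∈ nbr2 0,
        (1 / 4 * ((wedge v u : ℤ) : ℂ) * ((hhat v : ℝ) : ℂ) * ((freeKer s (w - v - u) : ℝ) : ℂ)) • η[u] := by
    rw [Finset.smul_sum]
    refine Finset.sum_congr rfl fun v _ => ?_
    rw [Finset.smul_sum]
    refine Finset.sum_congr rfl fun u _ => ?_
    rw [smul_smul]; congr 1; ring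
  -- the scalar coefficient of `1`: `c(r) = r c₁ + r² c₂`
  have hC : ∀ v : Site 4, ∀ X Y : ℝ, (((-1 / 8 * hhat v * ((r / s) ^ 2 * X - (s - r) * r / s * Y) : ℝ)) : ℂ) =
      (r : ℂ) * (((1 / 8 * hhat v * Y : ℝ)) : ℂ) + (r : ℂ) ^ 2 * (((-1 / 8 * hhat v * (X / s ^ 2 + Y / s) : ℝ)) : ℂ) := by
    intro v X Y
    push_cast
    field_simp
    ring
  rw [hB, hD, hE]
  simp only [Complex.ofReal_sum, hC, Finset.sum_add_distrib, ← Finset.mul_sum, add_smul, smul_add, ← smul_smul]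
  rw [← Complex.ofReal_sum, ← Complex.ofReal_sum]
  abel

/-- **The closed form regrouped by powers of `s`**: `E₂cf(s)(w) = −(s • P₀ + (s²/2) • P₁ + (s³/3) • P₂)`. -/
theorem pert2_closed_eq_poly {s : ℝ} (hs : 0 < s) (w : Site 4) :
    ∑ v ∈ nbr2 0, ((s : ℂ) / 8 * ((freeKer s (w - v) : ℝ) : ℂ)) • η'[v] +
        ∑ v ∈ nbr2 0, ((s : ℂ) / 8 * ((wedge v w : ℤ) : ℂ) * ((freeKer s (w - v) : ℝ) : ℂ)) • η[v] +
        (((∑ v ∈ nbr2 0, hhat v * (s / 24 * (((wedge v w : ℤ) : ℝ) ^ 2 * freeKer s (w - v)) -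
          s ^ 2 / 48 *
            (((v 0 : ℤ) : ℝ) ^ 2 * ∑ z ∈ nbr2 0, ((z 1 : ℤ) : ℝ) * ((z 1 : ℤ) : ℝ) * hhat z * freeKer s (w - v - z) -
              2 * ((v 0 : ℤ) : ℝ) * ((v 1 : ℤ) : ℝ) *
                ∑ z ∈ nbr2 0, ((z 0 : ℤ) : ℝ) * ((z 1 : ℤ) : ℝ) * hhat z * freeKer s (w - v - z) +
              ((v 1 : ℤ) : ℝ) ^ 2 * ∑ z ∈ nbr2 0, ((z 0 : ℤ) : ℝ) * ((z 0 : ℤ) : ℝ) * hhat z * freeKer s (w - v - z))) : ℝ)) : ℂ) • (1 : Spin) +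
        ∑ v ∈ nbr2 0, ∑ u ∈ nbr2 0, (-(s : ℂ) ^ 2 / 8 * ((freeKer s (w - v - u) : ℝ) : ℂ)) • (η[v] * η[u]) +
        ∑ v ∈ nbr2 0, ∑ u ∈ nbr2 0,
          (-(s : ℂ) ^ 2 / 8 * ((wedge v u : ℤ) : ℂ) * ((hhat v : ℝ) : ℂ) * ((freeKer s (w - v - u) : ℝ) : ℂ)) • η[u] =
      -((s : ℂ) • ∑ v ∈ nbr2 0, (-1 / 8 * ((freeKer s (w - v) : ℝ) : ℂ)) • η'[v] +
        ((s : ℂ) ^ 2 / 2) • (∑ v ∈ nbr2 0, (-1 / 4 / (s : ℂ) * ((wedge v w : ℤ) : ℂ) * ((freeKer s (w - v) : ℝ) : ℂ)) • η[v] +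
          (((∑ v ∈ nbr2 0, 1 / 8 * hhat v *
            (((v 0 : ℤ) : ℝ) ^ 2 * ∑ z ∈ nbr2 0, ((z 1 : ℤ) : ℝ) * ((z 1 : ℤ) : ℝ) * hhat z * freeKer s (w - v - z) -
              2 * ((v 0 : ℤ) : ℝ) * ((v 1 : ℤ) : ℝ) *
                ∑ z ∈ nbr2 0, ((z 0 : ℤ) : ℝ) * ((z 1 : ℤ) : ℝ) * hhat z * freeKer s (w - v - z) +
              ((v 1 : ℤ) : ℝ) ^ 2 * ∑ z ∈ nbr2 0, ((z 0 : ℤ) : ℝ) * ((z 0 : ℤ) : ℝ) * hhat z * freeKer s (w - v - z)) :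
            ℝ)) : ℂ) • (1 : Spin) +
          ∑ v ∈ nbr2 0, ∑ u ∈ nbr2 0, (1 / 4 * ((freeKer s (w - v - u) : ℝ) : ℂ)) • (η[v] * η[u]) +
          ∑ v ∈ nbr2 0, ∑ u ∈ nbr2 0,
            (1 / 4 * ((wedge v u : ℤ) : ℂ) * ((hhat v : ℝ) : ℂ) * ((freeKer s (w - v - u) : ℝ) : ℂ)) • η[u]) +
        ((s : ℂ) ^ 3 / 3) • ((((∑ v ∈ nbr2 0, -1 / 8 * hhat v *
            ((((wedge v w : ℤ) : ℝ) ^ 2 * freeKer s (w - v)) / s ^ 2 +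
              (((v 0 : ℤ) : ℝ) ^ 2 * ∑ z ∈ nbr2 0, ((z 1 : ℤ) : ℝ) * ((z 1 : ℤ) : ℝ) * hhat z * freeKer s (w - v - z) -
              2 * ((v 0 : ℤ) : ℝ) * ((v 1 : ℤ) : ℝ) *
                ∑ z ∈ nbr2 0, ((z 0 : ℤ) : ℝ) * ((z 1 : ℤ) : ℝ) * hhat z * freeKer s (w - v - z) +
              ((v 1 : ℤ) : ℝ) ^ 2 * ∑ z ∈ nbr2 0, ((z 0 : ℤ) : ℝ) * ((z 0 : ℤ) : ℝ) * hhat z * freeKer s (w - v - z)) / s) :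
            ℝ)) : ℂ) • (1 : Spin))) := by
  have hs' : (s : ℂ) ≠ 0 := Complex.ofReal_ne_zero.mpr hs.ne'
  have hsR : s ≠ 0 := hs.ne'
  have hT1 : ∑ v ∈ nbr2 0, ((s : ℂ) / 8 * ((freeKer s (w - v) : ℝ) : ℂ)) • η'[v] =
      -((s : ℂ) • ∑ v ∈ nbr2 0, (-1 / 8 * ((freeKer s (w - v) : ℝ) : ℂ)) • η'[v]) := by
    rw [Finset.smul_sum, ← Finset.sum_neg_distrib]
    refine Finset.sum_congr rfl fun v _ => ?_
    rw [smul_smul, ← neg_smul]; congr 1; ring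
  have hT2 : ∑ v ∈ nbr2 0, ((s : ℂ) / 8 * ((wedge v w : ℤ) : ℂ) * ((freeKer s (w - v) : ℝ) : ℂ)) • η[v] =
      -(((s : ℂ) ^ 2 / 2) • ∑ v ∈ nbr2 0,
        (-1 / 4 / (s : ℂ) * ((wedge v w : ℤ) : ℂ) * ((freeKer s (w - v) : ℝ) : ℂ)) • η[v]) := by
    rw [Finset.smul_sum, ← Finset.sum_neg_distrib]
    refine Finset.sum_congr rfl fun v _ => ?_
    rw [smul_smul, ← neg_smul]; congr 1; field_simp; ring
  have hT4 : ∑ v ∈ nbr2 0, ∑ u ∈ nbr2 0, (-(s : ℂ) ^ 2 / 8 * ((freeKer s (w - v - u) : ℝ) : ℂ)) • (η[v] * η[u]) =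
      -(((s : ℂ) ^ 2 / 2) • ∑ v ∈ nbr2 0, ∑ u ∈ nbr2 0, (1 / 4 * ((freeKer s (w - v - u) : ℝ) : ℂ)) • (η[v] * η[u])) := by
    rw [Finset.smul_sum, ← Finset.sum_neg_distrib]
    refine Finset.sum_congr rfl fun v _ => ?_
    rw [Finset.smul_sum, ← Finset.sum_neg_distrib]
    refine Finset.sum_congr rfl fun u _ => ?_
    rw [smul_smul, ← neg_smul]; congr 1; ring
  have hT5 : ∑ v ∈ nbr2 0, ∑ u ∈ nbr2 0,
      (-(s : ℂ) ^ 2 / 8 * ((wedge v u : ℤ) : ℂ) * ((hhat v : ℝ) : ℂ) * ((freeKer s (w - v - u) : ℝ) : ℂ)) • η[u] =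
      -(((s : ℂ) ^ 2 / 2) • ∑ v ∈ nbr2 0, ∑ u ∈ nbr2 0,
        (1 / 4 * ((wedge v u : ℤ) : ℂ) * ((hhat v : ℝ) : ℂ) * ((freeKer s (w - v - u) : ℝ) : ℂ)) • η[u]) := by
    rw [Finset.smul_sum, ← Finset.sum_neg_distrib]
    refine Finset.sum_congr rfl fun v _ => ?_
    rw [Finset.smul_sum, ← Finset.sum_neg_distrib]
    refine Finset.sum_congr rfl fun u _ => ?_
    rw [smul_smul, ← neg_smul]; congr 1; ring
  have hT3 : ∀ v : Site 4, ∀ X Y : ℝ, (((hhat v * (s / 24 * X - s ^ 2 / 48 * Y) : ℝ)) : ℂ) =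
      -((s : ℂ) ^ 2 / 2 * (((1 / 8 * hhat v * Y : ℝ)) : ℂ) +
        (s : ℂ) ^ 3 / 3 * (((-1 / 8 * hhat v * (X / s ^ 2 + Y / s) : ℝ)) : ℂ)) := by
    intro v X Y
    push_cast
    field_simp
    ring
  rw [hT1, hT2, hT4, hT5]
  simp only [Complex.ofReal_sum, hT3, Finset.sum_add_distrib, ← Finset.mul_sum, add_smul, smul_add, ← smul_smul,
    Finset.sum_neg_distrib, neg_smul, neg_add]
  rw [← Complex.ofReal_sum, ← Complex.ofReal_sum]
  abel

/-- **The second-order term in closed form**: for `s > 0`, entrywise,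
`−∫₀ˢ freeConv (s−r) (vtx 2 (pert0 r) + vtx 1 (pert1 r)) w dr = E₂cf(s)(w)`. -/
theorem neg_integral_freeConv_forcing_apply
    (h1 : ∀ x y : Site 4, sqKer (fun _ => (1 : ℂ)) x y = ((hhat (y - x) : ℝ) : ℂ) • (1 : Spin))
    (h3 : ∀ w : Site 4, freeKer 0 w = if w = 0 then 1 else 0)
    (h5 : ∀ s r : ℝ, 0 ≤ s → 0 ≤ r → ∀ w : Site 4,
      HasSum (fun y : Site 4 => freeKer s y * freeKer r (w - y)) (freeKer (s + r) w))
    (h6 : ∀ t : ℝ, 0 ≤ t → ∀ (w : Site 4) (ν : Fin 4),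
      t * (∑ z ∈ nbr2 0, ((z ν : ℤ) : ℝ) * hhat z * freeKer t (w - z)) + ((w ν : ℤ) : ℝ) * freeKer t w = 0)
    {s : ℝ} (hs : 0 < s) (w : Site 4) (α β : Fin 4) :
    -∫ r in (0 : ℝ)..s, freeConv (s - r) (fun y => vtx 2 (pert0 r) y + vtx 1 (pert1 r) y) w α β =
      (∑ v ∈ nbr2 0, ((s : ℂ) / 8 * ((freeKer s (w - v) : ℝ) : ℂ)) • η'[v] +
        ∑ v ∈ nbr2 0, ((s : ℂ) / 8 * ((wedge v w : ℤ) : ℂ) * ((freeKer s (w - v) : ℝ) : ℂ)) • η[v] +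
        (((∑ v ∈ nbr2 0, hhat v * (s / 24 * (((wedge v w : ℤ) : ℝ) ^ 2 * freeKer s (w - v)) -
          s ^ 2 / 48 *
            (((v 0 : ℤ) : ℝ) ^ 2 * ∑ z ∈ nbr2 0, ((z 1 : ℤ) : ℝ) * ((z 1 : ℤ) : ℝ) * hhat z * freeKer s (w - v - z) -
              2 * ((v 0 : ℤ) : ℝ) * ((v 1 : ℤ) : ℝ) *
                ∑ z ∈ nbr2 0, ((z 0 : ℤ) : ℝ) * ((z 1 : ℤ) : ℝ) * hhat z * freeKer s (w - v - z) +
              ((v 1 : ℤ) : ℝ) ^ 2 * ∑ z ∈ nbr2 0, ((z 0 : ℤ) : ℝ) * ((z 0 : ℤ) : ℝ) * hhat z * freeKer s (w - v - z))) : ℝ)) : ℂ) • (1 : Spin) +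
        ∑ v ∈ nbr2 0, ∑ u ∈ nbr2 0, (-(s : ℂ) ^ 2 / 8 * ((freeKer s (w - v - u) : ℝ) : ℂ)) • (η[v] * η[u]) +
        ∑ v ∈ nbr2 0, ∑ u ∈ nbr2 0,
          (-(s : ℂ) ^ 2 / 8 * ((wedge v u : ℤ) : ℂ) * ((hhat v : ℝ) : ℂ) * ((freeKer s (w - v - u) : ℝ) : ℂ)) • η[u]) α β := by
  have hcongr : Set.EqOn (fun r : ℝ => freeConv (s - r) (fun y => vtx 2 (pert0 r) y + vtx 1 (pert1 r) y) w α β)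
      (fun r : ℝ => (∑ v ∈ nbr2 0, (-1 / 8 * ((freeKer s (w - v) : ℝ) : ℂ)) • η'[v]) α β +
        ((∑ v ∈ nbr2 0, (-1 / 4 / (s : ℂ) * ((wedge v w : ℤ) : ℂ) * ((freeKer s (w - v) : ℝ) : ℂ)) • η[v] +
          (((∑ v ∈ nbr2 0, 1 / 8 * hhat v *
            (((v 0 : ℤ) : ℝ) ^ 2 * ∑ z ∈ nbr2 0, ((z 1 : ℤ) : ℝ) * ((z 1 : ℤ) : ℝ) * hhat z * freeKer s (w - v - z) -
              2 * ((v 0 : ℤ) : ℝ) * ((v 1 : ℤ) : ℝ) *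
                ∑ z ∈ nbr2 0, ((z 0 : ℤ) : ℝ) * ((z 1 : ℤ) : ℝ) * hhat z * freeKer s (w - v - z) +
              ((v 1 : ℤ) : ℝ) ^ 2 * ∑ z ∈ nbr2 0, ((z 0 : ℤ) : ℝ) * ((z 0 : ℤ) : ℝ) * hhat z * freeKer s (w - v - z)) :
            ℝ)) : ℂ) • (1 : Spin) +
          ∑ v ∈ nbr2 0, ∑ u ∈ nbr2 0, (1 / 4 * ((freeKer s (w - v - u) : ℝ) : ℂ)) • (η[v] * η[u]) +
          ∑ v ∈ nbr2 0, ∑ u ∈ nbr2 0,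
            (1 / 4 * ((wedge v u : ℤ) : ℂ) * ((hhat v : ℝ) : ℂ) * ((freeKer s (w - v - u) : ℝ) : ℂ)) • η[u])) α β * (r : ℂ) +
        (((((∑ v ∈ nbr2 0, -1 / 8 * hhat v *
            ((((wedge v w : ℤ) : ℝ) ^ 2 * freeKer s (w - v)) / s ^ 2 +
              (((v 0 : ℤ) : ℝ) ^ 2 * ∑ z ∈ nbr2 0, ((z 1 : ℤ) : ℝ) * ((z 1 : ℤ) : ℝ) * hhat z * freeKer s (w - v - z) -
              2 * ((v 0 : ℤ) : ℝ) * ((v 1 : ℤ) : ℝ) *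
                ∑ z ∈ nbr2 0, ((z 0 : ℤ) : ℝ) * ((z 1 : ℤ) : ℝ) * hhat z * freeKer s (w - v - z) +
              ((v 1 : ℤ) : ℝ) ^ 2 * ∑ z ∈ nbr2 0, ((z 0 : ℤ) : ℝ) * ((z 0 : ℤ) : ℝ) * hhat z * freeKer s (w - v - z)) / s) :
            ℝ)) : ℂ) • (1 : Spin))) α β * (r : ℂ) ^ 2) (Set.uIcc 0 s) := by
    intro r hr
    rw [Set.uIcc_of_le hs.le] at hr
    simp only
    rw [freeConv_forcing h1 h3 h5 h6 hs hr.1 hr.2 w, forcing_collapsed_eq_poly hs r w]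
    simp only [Matrix.add_apply, Matrix.smul_apply, smul_eq_mul]
    ring
  rw [intervalIntegral.integral_congr hcongr, integral_quadratic, pert2_closed_eq_poly hs w]
  simp only [Matrix.neg_apply, Matrix.add_apply, Matrix.smul_apply, smul_eq_mul]
  ring

/-! ## Registered headline -/

/-- Registered headline of this helper file (aux stub `stub_secondOrderExpansionAuxF` of crux
stmt-QuantumFields-16786, line `Sketch`): the closed form of the second-order Duhamel term. -/
theorem stub_secondOrderExpansionAuxF : (∀ x y : Site 4, sqKer (fun _ => (1 : ℂ)) x y = ((hhat (y - x) : ℝ) : ℂ) • (1 : Spin)) → (∀ w : Site 4, freeKer 0 w = if w = 0 then 1 else 0) → (∀ s r : ℝ, 0 ≤ s → 0 ≤ r → ∀ w : Site 4, HasSum (fun y : Site 4 => freeKer s y * freeKer r (w - y)) (freeKer (s + r) w)) → (∀ t : ℝ, 0 ≤ t → ∀ (w : Site 4) (ν : Fin 4), t * (∑ z ∈ nbr2 0, ((z ν : ℤ) : ℝ) * hhat z * freeKer t (w - z)) + ((w ν : ℤ) : ℝ) * freeKer t w = 0) → ∀ (s : ℝ), 0 < s → ∀ (w : Site 4) (α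 β : Fin 4), -∫ r in (0 : ℝ)..s, freeConv (s - r) (fun y => vtx 2 (pert0 r) y + vtx 1 (pert1 r) y) w α β = (∑ v ∈ nbr2 0, ((s : ℂ) / 8 * ((freeKer s (w - v) : ℝ) : ℂ)) • (∑ z ∈ nbr 0, (((wedge z v : ℤ) : ℂ) ^ 2) • (dsharp z * dsymb (v - z))) +
        ∑ v ∈ nbr2 0, ((s : ℂ) / 8 * ((wedge v w : ℤ) : ℂ) * ((freeKer s (w - v) : ℝ) : ℂ)) • (∑ z ∈ nbr 0, ((wedge z v : ℤ) : ℂ) • (dsharp z * dsymb (v - z))) +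
        (((∑ v ∈ nbr2 0, hhat v * (s / 24 * (((wedge v w : ℤ) : ℝ) ^ 2 * freeKer s (w - v)) -
          s ^ 2 / 48 *
            (((v 0 : ℤ) : ℝ) ^ 2 * ∑ z ∈ nbr2 0, ((z 1 : ℤ) : ℝ) * ((z 1 : ℤ) : ℝ) * hhat z * freeKer s (w - v - z) -
              2 * ((v 0 : ℤ) : ℝ) * ((v 1 : ℤ) : ℝ) *
                ∑ z ∈ nbr2 0, ((z 0 : ℤ) : ℝ) * ((z 1 : ℤ) : ℝ) * hhat z * freeKer s (w - v - z) +
              ((v 1 : ℤ) : ℝ) ^ 2 * ∑ z ∈ nbr2 0, ((z 0 : ℤ) : ℝ) * ((z 0 : ℤ) : ℝ) * hhat z * freeKer s (w - v - z))) : ℝ)) : ℂ) • (1 : Spin) +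
        ∑ v ∈ nbr2 0, ∑ u ∈ nbr2 0, (-(s : ℂ) ^ 2 / 8 * ((freeKer s (w - v - u) : ℝ) : ℂ)) • ((∑ z ∈ nbr 0, ((wedge z v : ℤ) : ℂ) • (dsharp z * dsymb (v - z))) * (∑ z ∈ nbr 0, ((wedge z u : ℤ) : ℂ) • (dsharp z * dsymb (u - z)))) +
        ∑ v ∈ nbr2 0, ∑ u ∈ nbr2 0,
          (-(s : ℂ) ^ 2 / 8 * ((wedge v u : ℤ) : ℂ) * ((hhat v : ℝ) : ℂ) * ((freeKer s (w - v - u) : ℝ) : ℂ)) • (∑ z ∈ nbr 0, ((wedge z u : ℤ) : ℂ) • (dsharp z * dsymb (u - z)))) α β :=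
  fun h1 h3 h5 h6 _ hs w α β => neg_integral_freeConv_forcing_apply h1 h3 h5 h6 hs w α β

end Summit.QuantumFields.QCD.Cruxes.QuarkLoopCoefficient.Sketch.SecondOrderExpansion

end
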